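import Summits.CriticalPhenomena.PercolationContinuityZ3.Theorems.PercNearOneGluingNoHeavyLowerTailSahiCTCLadderCountsGeneral
import HarnessLib

/-!
# `NoHeavyLowerTail` (crux stmt-CriticalPhenomena-4575), P3 lane: glue between the general row lemmas

Support file (seat `prim-l12-p3`, gen 26; `--supports stmt-CriticalPhenomena-4575`).  Two bookkeeping identities used by every row of
`(L_t)`: the all-cubes sum of `cubes_le_coeff_ee_mul_harris_general` splits by the type `i = #A` into the per-type sums of
`type_plain_supply` / `type_pinned_supply` (`sum_cubes_by_type`), and the kind counts of `coeff_chargeT_le_kinds` for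
`W = W_t(𝒳,𝒵)` are the `kindsAll` counts (`card_charge_kinds_eq_kindsAll`).  Nothing is asserted about the crux.
-/

namespace Summit.CriticalPhenomena.PercolationContinuityZ3.Theorems.SahiCTCForms

open Finset MvPolynomial SahiCTCGenFun SahiCTCWeightedLYM

variable {α : Type*} [DecidableEq α] [Fintype α]

section GlueGeneral
variable {𝒳 𝒵 : Finset (Finset α)}

omit [Fintype α] in
/-- **Cubes by type** (`#D ≤ t`): `Σ_{(A,Y) : A ⊆ D, Y ⊆ T, #A + #Y = t} f = Σ_{i ≤ #D} Σ_{A ∈ binom(D,i), Y ∈ binom(T,t−i)} f`. [this work] -/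
theorem sum_cubes_by_type {D : Finset α} (T : Finset α) {t : ℕ} (hDt : #D ≤ t) (f : Finset α × Finset α → ℤ) :
    ∑ q ∈ ((D.powerset ×ˢ T.powerset).filter fun q => #q.1 + #q.2 = t), f q
      = ∑ i ∈ range (#D + 1), ∑ c ∈ D.powersetCard i ×ˢ T.powersetCard (t - i), f c := by
  rw [← sum_biUnion]
  · refine sum_congr ?_ fun _ _ => rfl
    ext q
    simp only [mem_filter, mem_product, mem_powerset, mem_biUnion, mem_range, mem_powersetCard]
    constructor
    · rintro ⟨⟨hA, hY⟩, ht⟩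
      exact ⟨#q.1, Nat.lt_succ_of_le (card_le_card hA), ⟨hA, rfl⟩, hY, by omega⟩
    · rintro ⟨i, hi, ⟨hA, hAi⟩, hY, hYi⟩
      refine ⟨⟨hA, hY⟩, ?_⟩
      rw [hAi, hYi]
      omega
  · intro i _ j _ hij
    refine disjoint_left.2 fun q hqi hqj => hij ?_
    have h1 := (mem_powersetCard.1 (mem_product.1 hqi).1).2
    have h2 := (mem_powersetCard.1 (mem_product.1 hqj).1).2
    rw [← h1, ← h2]

omit [Fintype α] in
/-- **Charge kinds are `kindsAll`**: for `W = {S ∈ 𝒳 ∩ 𝒵 : #S = t}` and `j ≤ t`, the pairs `(A', Y')` of `coeff_chargeT_le_kinds`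
with `A' ∪ Y' ∈ W` are exactly `kindsAll 𝒳 𝒵 m t j`. [this work] -/
theorem card_charge_kinds_eq_kindsAll (m : α →₀ ℕ) {t j : ℕ} (hjt : j ≤ t) :
    #((((dbl m).powersetCard j) ×ˢ ((lev m 1).powersetCard (t - j))).filter fun q =>
        q.1 ∪ q.2 ∈ (𝒳 ∩ 𝒵).filter fun S => #S = t) = #(kindsAll 𝒳 𝒵 m t j) := by
  unfold kindsAll
  refine congrArg card (filter_congr fun q hq => ?_)
  obtain ⟨hA, hY⟩ := mem_product.1 hq
  obtain ⟨hAD, hAc⟩ := mem_powersetCard.1 hA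
  obtain ⟨hYT, hYc⟩ := mem_powersetCard.1 hY
  have hcard : #(q.1 ∪ q.2) = t := by
    rw [card_union_of_disjoint (Disjoint.mono hAD hYT (disjoint_dbl_lev_one m)), hAc, hYc]; omega
  rw [mem_filter, mem_inter]
  tauto

end GlueGeneral

end Summit.CriticalPhenomena.PercolationContinuityZ3.Theorems.SahiCTCForms
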